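import Literature.NumberTheory.Automorphic.LanglandsTunnellBridge
import Literature.NumberTheory.Automorphic.AutomorphicRepsGLSatakeFlathProofs
import Literature.NumberTheory.GaloisRepresentations.ArtinEulerFactorSpecProofs
import Literature.NumberTheory.GaloisRepresentations.GaloisRepFrobeniusProofs
import HarnessLib

/-!
# Gelbart's Prop. 4.1 (`π(σ)` a.e. ⇒ `π_v = π(σ_v)` at every unramified place): the local
rigidity step of the printed proof (pure proofs; companion to `Automorphic/StrongArtinGL2`)

The named fact `Literature.NumberTheory.Automorphic.frobSatakeCompatibleAt_of_isPiOfArtinRep`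
(`Automorphic/StrongArtinGL2`; Gelbart, *Three lectures …* (1997), Prop. 4.1, whose proof is
deferred to Langlands, *Base change for GL(2)* (1980), §3, pp. 23–24, i.e. to the argument
concluding the proof of Jacquet–Langlands, *Automorphic Forms on GL(2)*, LNM 114 (1970),
Thm. 12.2, pp. 209–211 of the retypeset edition) says: if the cuspidal `π` of `GL_2(𝔸_F)` is
`π(σ)` at almost every place, then at **every** finite place `v` where `π` has a Satake
parameter `α`, `σ` is unramified and `charpoly σ(Frob_v) = ∏_{a ∈ α} (X - a)`.
The printed proof has two halves.  **Global half** (Jacquet–Langlands, pp. 209–210): the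
functional equations of `L(s, ω ⊗ π)` (Thm. 11.1, Cor. 11.2) and of `L(s, ω ⊗ σ)` for an idèle
class character `ω` prescribed at `v` and highly ramified at the other exceptional places
(Lemma 12.5), with the stability of the local constants under such twists (Prop. 3.8; Deligne),
leave the **single-place identity (12.5.1)**
`L(1 - s, ω_v⁻¹ ⊗ π̃_v) / L(s, ω_v ⊗ π_v) = {ε-quotient} · L(1 - s, ω_v⁻¹ ⊗ σ̃_v) / L(s, ω_v ⊗ σ_v)`.
**Local half** (p. 211): compare the zeros and poles of the two sides.  This file **proves the
local half in the configuration of Prop. 4.1** (`π_v` unramified with Satake parameter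
`{a₁, a₂}`, `σ_v` arbitrary) in a tolerant form that the global half can feed, and the
Galois-side dictionary turning its conclusion into that of the named fact:

* `eq_pair_of_eulerTerm_identity` — **rigidity of a single Euler factor** (the zero-counting of
  Jacquet–Langlands p. 211 / Deligne–Serre 1974, Lemma 4.9, at one place, with *no* size
  condition on the roots): if `Ψ(s) (1 - a₁ q^{-s})(1 - a₂ q^{-s}) = Φ(s) ∏_{b ∈ β} (1 - b q^{-s})`
  off a closed set `E` meeting the zeros of `1 - aᵢ q^{-s}` in finitely many points, `Φ, Ψ`
  continuous off `E`, `Φ` non-vanishing off `E`, `aᵢ ≠ 0`, `card β ≤ 2`, then `β = {a₁, a₂}`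
  (`Φ` absorbs the `ε`-quotient, the archimedean `Γ`-quotients and the dual factor
  `∏ (1 - aᵢ⁻¹ q^{-(1-s)})`, whose zeros avoid those of `1 - aⱼ q^{-s}` iff `aⱼ ≠ q aᵢ`,
  `eulerTerm_inv_one_sub_ne_zero`; `Ψ` absorbs the dual Artin factor).
* `isUnramifiedAt_and_hasFrobCharpolyAt_of_eval_eulerFactorAt` — **Galois dictionary**: if
  `L_v(σ, T) = det(1 - T σ(Frob) | V^{I_v}) = (1 - a₁ T)(1 - a₂ T)` with `aᵢ ≠ 0`, then
  `dim V^{I_v} = 2`, `σ` is unramified at `v` and `charpoly σ(Frob_v) = (X - a₁)(X - a₂)`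
  (Neukirch VII §10, (10.1), read backwards).
* `frobSatake_of_local_identity` — the two combined: Prop. 4.1 at `v` from (12.5.1) at `v`
  (tolerant form), for `α` with `0 ∉ α` and `a ≠ q_v b` for `a, b ∈ α` (`π_v` infinite-dimensional,
  Jacquet–Langlands p. 211).
* `IsPiOfArtinRep.eventually_forall_frobSatake` — the almost-everywhere shadow of the named fact
  is a theorem (`AutomorphicRepData.hasSatakeParamAt_unique_holds`); the content of Prop. 4.1 is
  at the finitely many exceptional places.
* `frobSatakeCompatibleAt_of_isPiOfArtinRep_of_local_identities` — hence the named fact follows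
  from its global half alone (stated inline: (12.5.1), tolerant form, at every place where `π`
  has a Satake parameter, for non-zero generic `α`).

What is deliberately NOT here: the global half (Jacquet–Langlands Thm. 11.1, Cor. 11.2,
Lemma 12.5, Prop. 3.8 for the Borel–Jacquet datum `CuspidalAutomorphicRepData`), which the tree
does not have; no new definition and no named fact is introduced (D-0026).

## References

* H. Jacquet, R. P. Langlands, *Automorphic Forms on GL(2)*, LNM 114 (1970): proof of Thm. 12.2,
  pp. 209–211 (retypeset ed.), (12.5.1), Lemma 12.5, Prop. 3.8, Thm. 11.1. [JacquetLanglands1970]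
* S. Gelbart, *Three lectures on the modularity of `ρ̄_{E,3}` …*, in *Modular Forms and Fermat's
  Last Theorem* (1997): Prop. 4.1, Thm. 3.2, Example 3.2.3. [Gelbart1997]
* P. Deligne, J.-P. Serre, *Formes modulaires de poids 1*, Ann. Sci. ÉNS (4) 7 (1974):
  Lemma 4.9 and proof of Thm. 4.6 (iii)–(iv), pp. 515–516. [DeligneSerreASENS1974]
* J. Neukirch, *Algebraic Number Theory* (1999), VII §10, (10.1). [NeukirchANT1999]
-/

noncomputable section

open scoped MatrixGroups NumberField Polynomial
open NumberField IsDedekindDomain Field Polynomial Complex Filter Topology Set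
open Literature.NumberTheory.GaloisRepresentations (ArtinRep FramedArtinRep)
open Literature.NumberTheory.LFunctions

namespace Literature.NumberTheory.Automorphic

/-! ### Rigidity of one Euler factor (Jacquet–Langlands p. 211; Deligne–Serre Lemma 4.9) -/

section Analytic

variable {q : ℕ}

/-- Off any set `E` meeting the zero set of `1 - a q^{-s}` (`a ≠ 0`, `q > 1`) in finitely many
points there is a zero of `1 - a q^{-s}`: the zero set is infinite
(`infinite_setOf_eulerTerm_eq_zero`; Deligne–Serre 1974, proof of Lemma 4.9). [folklore] -/
theorem exists_eulerTerm_eq_zero_and_not_mem (hq : 1 < q) {a : ℂ} (ha : a ≠ 0) {E : Set ℂ}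
    (hE : {s | s ∈ E ∧ eulerTerm q a s = 0}.Finite) : ∃ s, eulerTerm q a s = 0 ∧ s ∉ E := by
  obtain ⟨s, hs, hs'⟩ := ((infinite_setOf_eulerTerm_eq_zero hq ha).sdiff hE).nonempty
  exact ⟨s, hs, fun h => hs' ⟨h, hs⟩⟩

/-- **One root.**  If `L(s) (1 - a q^{-s}) = Φ(s) ∏_{b ∈ β} (1 - b q^{-s})` off a set `E` on
whose complement `Φ` does not vanish and which meets the zeros of `1 - a q^{-s}` (`a ≠ 0`) in
finitely many points, then `a ∈ β`: at a zero `s ∉ E` of `1 - a q^{-s}` some `1 - b q^{-s}`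
vanishes, and `a q^{-s} = 1 = b q^{-s}` forces `b = a` (Jacquet–Langlands 1970, p. 211;
Deligne–Serre 1974, proof of Lemma 4.9). [cite: DeligneSerreASENS1974, Lemma 4.9 (proof)] -/
theorem mem_of_eulerTerm_identity (hq : 1 < q) {a : ℂ} (ha : a ≠ 0) {β : Multiset ℂ}
    {E : Set ℂ} (hE : {s | s ∈ E ∧ eulerTerm q a s = 0}.Finite) {L Φ : ℂ → ℂ}
    (hΦ : ∀ s, s ∉ E → Φ s ≠ 0)
    (hid : ∀ s, s ∉ E → L s * eulerTerm q a s = Φ s * (β.map fun b => eulerTerm q b s).prod) :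
    a ∈ β := by
  obtain ⟨s, hs, hsE⟩ := exists_eulerTerm_eq_zero_and_not_mem hq ha hE
  have h := hid s hsE
  rw [hs, mul_zero, eq_comm, mul_eq_zero] at h
  rcases h with h | h
  · exact absurd h (hΦ s hsE)
  · rw [Multiset.prod_eq_zero_iff, Multiset.mem_map] at h
    obtain ⟨b, hb, hbs⟩ := h
    rwa [eq_of_eulerTerm_eq_zero hs hbs]

/-- **Cancellation of an Euler term.**  If `(1 - a q^{-s}) f(s) = (1 - a q^{-s}) g(s)` off a
closed set `E`, with `f, g` continuous off `E`, then `f = g` off `E`: the two agree off the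
countable zero set of `1 - a q^{-s}`, whose complement is dense (`Set.Countable.dense_compl`),
and continuity does the rest (the device of Deligne–Serre 1974, proof of Lemma 4.9, "réduction").
[folklore] -/
theorem eq_of_eulerTerm_mul_eq (hq : 1 < q) (a : ℂ) {E : Set ℂ} (hEc : IsClosed E)
    {f g : ℂ → ℂ} (hf : ContinuousOn f Eᶜ) (hg : ContinuousOn g Eᶜ)
    (h : ∀ s, s ∉ E → eulerTerm q a s * f s = eulerTerm q a s * g s) :
    ∀ s, s ∉ E → f s = g s := by
  have hsub : Eᶜ ⊆ closure (Eᶜ ∩ {s : ℂ | eulerTerm q a s = 0}ᶜ) :=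
    (Set.Countable.dense_compl ℂ (countable_setOf_eulerTerm_eq_zero hq a)).open_subset_closure_inter
      hEc.isOpen_compl
  have heq : EqOn f g (Eᶜ ∩ {s : ℂ | eulerTerm q a s = 0}ᶜ) := fun s hs =>
    mul_left_cancel₀ (fun h0 => hs.2 h0) (h s hs.1)
  intro s hs
  exact heq.of_subset_closure hf hg Set.inter_subset_left hsub hs

/-- Continuity of a finite Euler product `s ↦ ∏_{b ∈ γ} (1 - b q^{-s})` (`q ≠ 0`). [folklore] -/
theorem continuous_multiset_prod_eulerTerm (hq : q ≠ 0) (γ : Multiset ℂ) :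
    Continuous fun s : ℂ => (γ.map fun b => eulerTerm q b s).prod :=
  continuous_multiset_prod γ fun b _ => continuous_eulerTerm hq b

/-- **Rigidity of a single Euler factor** (the zero-counting at one place of Jacquet–Langlands
1970, proof of Thm. 12.2, p. 211, and of Deligne–Serre 1974, Lemma 4.9 — here with no size
condition on the roots).  Let `q > 1`, `a₁, a₂ ≠ 0`, `β` a multiset with `card β ≤ 2`, `E ⊆ ℂ`
closed and meeting the zero sets of `1 - aᵢ q^{-s}` in finitely many points, `Φ, Ψ` continuous
off `E` with `Φ` non-vanishing off `E`, and suppose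
`Ψ(s) (1 - a₁ q^{-s})(1 - a₂ q^{-s}) = Φ(s) ∏_{b ∈ β} (1 - b q^{-s})` for all `s ∉ E`.  Then
`β = {a₁, a₂}`.  Proof: `a₁ ∈ β` (`mem_of_eulerTerm_identity`); cancel `1 - a₁ q^{-s}`
(`eq_of_eulerTerm_mul_eq`); then `a₂` lies in the rest of `β`; count.
[cite: JacquetLanglands1970, proof of Thm. 12.2, p. 211] -/
theorem eq_pair_of_eulerTerm_identity (hq : 1 < q) {a₁ a₂ : ℂ} (h₁ : a₁ ≠ 0) (h₂ : a₂ ≠ 0)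
    {β : Multiset ℂ} (hβ : Multiset.card β ≤ 2) {E : Set ℂ} (hEc : IsClosed E)
    (hE₁ : {s | s ∈ E ∧ eulerTerm q a₁ s = 0}.Finite)
    (hE₂ : {s | s ∈ E ∧ eulerTerm q a₂ s = 0}.Finite)
    {Φ Ψ : ℂ → ℂ} (hΦc : ContinuousOn Φ Eᶜ) (hΨc : ContinuousOn Ψ Eᶜ)
    (hΦ : ∀ s, s ∉ E → Φ s ≠ 0)
    (hid : ∀ s, s ∉ E →
      Ψ s * (eulerTerm q a₁ s * eulerTerm q a₂ s) = Φ s * (β.map fun b => eulerTerm q b s).prod) :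
    β = {a₁, a₂} := by
  have hq0 : q ≠ 0 := by omega
  have hmem₁ : a₁ ∈ β :=   -- Step 1: `a₁ ∈ β`
    mem_of_eulerTerm_identity hq h₁ hE₁ hΦ (L := fun s => Ψ s * eulerTerm q a₂ s)
      (fun s hs => by rw [← hid s hs]; ring)
  obtain ⟨β', rfl⟩ := Multiset.exists_cons_of_mem hmem₁
  -- Step 2: cancel `1 - a₁ q^{-s}`
  have hid' : ∀ s, s ∉ E →
      Ψ s * eulerTerm q a₂ s = Φ s * (β'.map fun b => eulerTerm q b s).prod := by
    refine eq_of_eulerTerm_mul_eq hq a₁ hEc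
      (hΨc.mul (continuous_eulerTerm hq0 a₂).continuousOn)
      (hΦc.mul (continuous_multiset_prod_eulerTerm hq0 β').continuousOn) fun s hs => ?_
    have h := hid s hs
    rw [Multiset.map_cons, Multiset.prod_cons] at h
    linear_combination h
  -- Step 3: `a₂ ∈ β'`
  have hmem₂ : a₂ ∈ β' := mem_of_eulerTerm_identity hq h₂ hE₂ hΦ hid'
  obtain ⟨β'', rfl⟩ := Multiset.exists_cons_of_mem hmem₂
  -- Step 4: count
  have h0 : β'' = 0 := by
    simp only [Multiset.card_cons] at hβ
    exact Multiset.card_eq_zero.mp (by omega)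
  subst h0
  rfl

/-- **The dual unramified factor does not interfere.**  At a zero `s` of `1 - a q^{-s}` the
dual term `1 - b⁻¹ q^{-(1 - s)}` (`b ≠ 0`) vanishes only if `a = q b` (`q^{s} = a` gives
`b⁻¹ q^{s - 1} = a / (q b)`): in Jacquet–Langlands 1970, p. 211, the poles of
`L(1 - s, μ_v⁻¹ ⊗ π̃_v)` and `L(s, μ_v ⊗ π_v)` differ as `π_v = π(μ_v, ν_v)` is infinite-dimensional.
[cite: JacquetLanglands1970, proof of Thm. 12.2, p. 211] -/
theorem eulerTerm_inv_one_sub_ne_zero (hq : 1 < q) {a b s : ℂ} (hb : b ≠ 0)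
    (hab : a ≠ q * b) (hs : eulerTerm q a s = 0) : eulerTerm q b⁻¹ (1 - s) ≠ 0 := by
  intro h0
  rw [eulerTerm_eq_zero_iff] at hs h0
  have hq0 : (q : ℂ) ≠ 0 := Nat.cast_ne_zero.mpr (by omega)
  have hne : (q : ℂ) ^ s ≠ 0 := fun h => hq0 (cpow_eq_zero_iff _ _ |>.mp h).1
  have hqs : (q : ℂ) ^ s = a := by rw [cpow_neg, mul_inv_eq_one₀ hne] at hs; exact hs.symm
  rw [neg_sub, cpow_sub _ _ hq0, cpow_one, hqs] at h0
  apply hab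
  field_simp at h0
  linear_combination h0

end Analytic

/-! ### Galois dictionary: a degree-two Euler factor forces unramifiedness -/

section Galois

variable {F : Type*} [Field F] [NumberField F]

/-- Two polynomials with the same reverse and the same degree are equal (coefficientwise,
Mathlib `Polynomial.coeff_reverse`). [folklore] -/
theorem eq_of_reverse_eq_of_natDegree_eq {p r : ℂ[X]} (h : p.reverse = r.reverse)
    (hd : p.natDegree = r.natDegree) : p = r := by
  ext n
  by_cases hn : n ≤ p.natDegree
  · have hc := congrArg (fun f : ℂ[X] => f.coeff (p.natDegree - n)) h
    simp only [coeff_reverse] at hc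
    rwa [← hd, revAt_le (Nat.sub_le _ _), Nat.sub_sub_self hn] at hc
  · rw [coeff_eq_zero_of_natDegree_lt (not_le.mp hn),
      coeff_eq_zero_of_natDegree_lt (hd ▸ not_le.mp hn)]

/-- `∏_{a ∈ α} (X - a)` has non-zero constant coefficient when `0 ∉ α`. [folklore] -/
theorem coeff_zero_satakePolynomial_ne_zero {α : Multiset ℂ} (h0 : (0 : ℂ) ∉ α) :
    (satakePolynomial α).coeff 0 ≠ 0 := by
  rw [coeff_zero_eq_eval_zero, satakePolynomial, eval_multiset_prod, Multiset.map_map]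
  simp only [Function.comp_def, eval_sub, eval_X, eval_C, zero_sub]
  exact fun h => by
    obtain ⟨a, ha, ha0⟩ := Multiset.mem_map.mp (Multiset.prod_eq_zero_iff.mp h)
    exact h0 (neg_eq_zero.mp ha0 ▸ ha)

/-- `∏_{a ∈ α} (1 - a X)` (the reverse of `∏ (X - a)`) has degree `card α` when `0 ∉ α`. [folklore] -/
theorem natDegree_eulerPolynomial_of_zero_not_mem {α : Multiset ℂ} (h0 : (0 : ℂ) ∉ α) :
    (eulerPolynomial α).natDegree = Multiset.card α := by
  have h := natDegree_eq_reverse_natDegree_add_natTrailingDegree (satakePolynomial α)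
  rw [natTrailingDegree_eq_zero.mpr (Or.inr (coeff_zero_satakePolynomial_ne_zero h0)), add_zero,
    natDegree_satakePolynomial, reverse_satakePolynomial] at h
  exact h.symm

/-- **A degree-two Euler factor forces unramifiedness and pins the Frobenius** (Neukirch,
*Algebraic Number Theory*, VII §10, (10.1), read backwards; converse of
`eulerFactorAt_eq_eulerPolynomial_of_hasFrobCharpolyAt`).  If the Euler factor of
`σ : Γ_F → GL_2(ℂ)` at `v` is `L_v(σ, T) = det(1 - T σ(Frob_𝔓) | V^{I_𝔓}) = (1 - a₁ T)(1 - a₂ T)`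
with `aᵢ ≠ 0`, then `2 = deg L_v ≤ dim V^{I_𝔓} ≤ 2`, so `V^{I_𝔓} = V`: `σ` is unramified at `v`
(`GaloisRep.isUnramifiedAt_of_isUnramifiedAtPrime_holds`), and for every arithmetic Frobenius
`τ` above `v`, `det(1 - T σ(τ)) = L_v(σ, T)` (`ArtinRep.eulerFactorAt_eq_eulerPolynomial`,
`ArtinRep.eulerPolynomial_eq_reverse_charpoly`), whence `charpoly σ(τ) = (X - a₁)(X - a₂)`.
[cite: NeukirchANT1999, VII §10, (10.1)] -/
theorem isUnramifiedAt_and_hasFrobCharpolyAt_of_eval_eulerFactorAt (σ : FramedArtinRep F 2)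
    (v : HeightOneSpectrum (𝓞 F)) {α : Multiset ℂ} (hcard : Multiset.card α = 2)
    (h0 : (0 : ℂ) ∉ α)
    (heval : ∀ z : ℂ, (σ.toArtinRep.eulerFactorAt v).eval z = (α.map fun a => 1 - a * z).prod) :
    σ.IsUnramifiedAt v ∧ σ.HasFrobCharpolyAt v (satakePolynomial α) := by
  -- (i) the Euler factor is the Euler polynomial of `α`, of degree `2`
  have hE : σ.toArtinRep.eulerFactorAt v = eulerPolynomial α :=
    Polynomial.funext fun z => by rw [heval z, eval_eulerPolynomial]
  have hdeg : (σ.toArtinRep.eulerFactorAt v).natDegree = 2 := by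
    rw [hE, natDegree_eulerPolynomial_of_zero_not_mem h0, hcard]
  -- (ii) the inertia invariants at a prime above `v` are everything
  obtain ⟨𝔓, h𝔓⟩ := HeightOneSpectrum.primesAbove_nonempty v
  obtain ⟨φ, hφ⟩ := HeightOneSpectrum.exists_isArithFrobAt_of_mem_primesAbove_holds h𝔓
  have hspec := GaloisRepresentations.ArtinRep.eulerFactorAt_eq_eulerPolynomial σ.toArtinRep h𝔓 hφ
  have hle : 2 ≤ Module.finrank ℂ
      (σ.toArtinRep.fixedSubmodule (𝔓.inertia (absoluteGaloisGroup F))) := by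
    have h : (σ.toArtinRep.eulerFactorAt v).natDegree ≤ Module.finrank ℂ
        (σ.toArtinRep.fixedSubmodule (𝔓.inertia (absoluteGaloisGroup F))) := by
      rw [hspec, GaloisRepresentations.ArtinRep.eulerPolynomial]
      exact (reverse_natDegree_le _).trans_eq (LinearMap.charpoly_natDegree _)
    rwa [hdeg] at h
  have htop : σ.toArtinRep.fixedSubmodule (𝔓.inertia (absoluteGaloisGroup F)) = ⊤ := by
    apply Submodule.eq_top_of_finrank_eq
    refine le_antisymm (Submodule.finrank_le _) ?_
    rwa [Module.finrank_fin_fun]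
  have hI : ∀ τ ∈ 𝔓.inertia (absoluteGaloisGroup F), σ.toArtinRep τ = 1 :=
    (GaloisRepresentations.ContinuousRep.fixedSubmodule_eq_top_iff _ _).mp htop
  -- (iii) unramified at `v`
  have hurG : σ.toGaloisRep.IsUnramifiedAt v :=
    GaloisRepresentations.GaloisRep.isUnramifiedAt_of_isUnramifiedAtPrime_holds h𝔓 hI
  have hur : σ.IsUnramifiedAt v :=
    (GaloisRepresentations.FramedGaloisRep.isUnramifiedAt_toGaloisRep_iff v σ).mp hurG
  refine ⟨hur, ?_⟩
  -- (iv) the characteristic polynomial of every Frobenius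
  rw [← GaloisRepresentations.FramedGaloisRep.hasFrobCharpolyAt_toGaloisRep_iff]
  intro 𝔓' h𝔓' τ hτ
  have h1 := GaloisRepresentations.ArtinRep.eulerFactorAt_eq_eulerPolynomial σ.toArtinRep h𝔓' hτ
  rw [GaloisRepresentations.ArtinRep.eulerPolynomial_eq_reverse_charpoly _ (hurG _ h𝔓'), hE,
    ← reverse_satakePolynomial] at h1
  refine eq_of_reverse_eq_of_natDegree_eq h1.symm ?_
  rw [LinearMap.charpoly_natDegree, Module.finrank_fin_fun, natDegree_satakePolynomial, hcard]

/-! ### The local half of Prop. 4.1: from (12.5.1) at `v` to `π_v = π(σ_v)` -/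

/-- **Gelbart's Prop. 4.1 at one place, from the single-place identity (12.5.1)**
(Jacquet–Langlands 1970, end of the proof of Thm. 12.2, pp. 210–211, in the configuration of
Gelbart 1997, Prop. 4.1: `π_v` unramified).  Let `σ : Γ_F → GL_2(ℂ)`, `v` finite, `q = q_v`,
`α = {a₁, a₂}` (the Satake parameter of `π_v`) with `aᵢ ≠ 0` and `a ≠ q b` for `a, b ∈ α`
(`π_v` infinite-dimensional).  Suppose that off a closed `E ⊆ ℂ` meeting the zeros of
`1 - aᵢ q^{-s}` in finitely many points (e.g. the zeros and poles of the archimedean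
`Γ`-quotients), with `Φ, Ψ` continuous off `E` and `Φ` non-vanishing off `E` (`Φ` = `ε`-quotient
times `Γ`-quotients, `Ψ` = the same times the dual Artin factor),
`Ψ(s) ∏_{a ∈ α} (1 - a q^{-s}) = Φ(s) · L_v(σ, q^{-s}) · ∏_{a ∈ α} (1 - a⁻¹ q^{-(1-s)})`, i.e.
`Ψ · L(s, π_v)⁻¹ = Φ · L(s, σ_v)⁻¹ · L(1 - s, π̃_v)⁻¹` (`L_v(σ, T) = ArtinRep.eulerFactorAt`).  Then
`σ` is unramified at `v` with `charpoly σ(Frob_v) = ∏_{a ∈ α} (X - a)`.  Proof: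
`L_v(σ, T) = ∏_{b ∈ β} (1 - b T)`, `card β ≤ 2` (`ArtinRep.exists_card_le_eval_eulerFactorAt_eq_prod`);
the dual factor joins `Φ` (`eulerTerm_inv_one_sub_ne_zero`); `eq_pair_of_eulerTerm_identity`
gives `β = α`; then `isUnramifiedAt_and_hasFrobCharpolyAt_of_eval_eulerFactorAt`.
[cite: JacquetLanglands1970, proof of Thm. 12.2, pp. 210–211, (12.5.1)] -/
theorem frobSatake_of_local_identity (σ : FramedArtinRep F 2) (v : HeightOneSpectrum (𝓞 F))
    {α : Multiset ℂ} (hcard : Multiset.card α = 2) (h0 : (0 : ℂ) ∉ α)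
    (hgen : ∀ a ∈ α, ∀ b ∈ α, a ≠ v.residueCard * b)
    {E : Set ℂ} (hEc : IsClosed E)
    (hEfin : ∀ a ∈ α, {s | s ∈ E ∧ eulerTerm v.residueCard a s = 0}.Finite)
    {Φ Ψ : ℂ → ℂ} (hΦc : ContinuousOn Φ Eᶜ) (hΨc : ContinuousOn Ψ Eᶜ)
    (hΦ : ∀ s, s ∉ E → Φ s ≠ 0)
    (hid : ∀ s, s ∉ E →
      Ψ s * (α.map fun a => eulerTerm v.residueCard a s).prod =
        Φ s * (σ.toArtinRep.eulerFactorAt v).eval ((v.residueCard : ℂ) ^ (-s)) *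
          (α.map fun a => eulerTerm v.residueCard a⁻¹ (1 - s)).prod) :
    σ.IsUnramifiedAt v ∧ σ.HasFrobCharpolyAt v (satakePolynomial α) := by
  set q := v.residueCard with hq_def
  have hq : 1 < q := v.one_lt_residueCard
  obtain ⟨a₁, a₂, rfl⟩ := Multiset.card_eq_two.mp hcard
  have ha₁ : a₁ ∈ ({a₁, a₂} : Multiset ℂ) := Multiset.mem_cons_self _ _
  have ha₂ : a₂ ∈ ({a₁, a₂} : Multiset ℂ) := by simp
  have h₁ : a₁ ≠ 0 := fun h => h0 (h ▸ ha₁)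
  have h₂ : a₂ ≠ 0 := fun h => h0 (h ▸ ha₂)
  obtain ⟨B, hBcard, -, hB⟩ :=   -- `L_v(σ, T) = ∏_{b ∈ B} (1 - b T)`, `card B ≤ 2`
    GaloisRepresentations.ArtinRep.exists_card_le_eval_eulerFactorAt_eq_prod σ.toArtinRep
      (GaloisRepresentations.ArtinRep.finite_range_holds (K := F) (V := Fin 2 → ℂ) σ.toArtinRep) v
  rw [Module.finrank_fin_fun] at hBcard
  -- the dual factor `D(s) = (1 - a₁⁻¹ q^{-(1-s)})(1 - a₂⁻¹ q^{-(1-s)})` joins `Φ`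
  set D : ℂ → ℂ := fun s => eulerTerm q a₁⁻¹ (1 - s) * eulerTerm q a₂⁻¹ (1 - s) with hD
  have hc : Continuous fun s : ℂ => 1 - s := continuous_const.sub continuous_id
  have hDc : Continuous D := ((continuous_eulerTerm (by omega) _).comp hc).mul
    ((continuous_eulerTerm (by omega) _).comp hc)
  have hDne : ∀ {a s : ℂ}, a ∈ ({a₁, a₂} : Multiset ℂ) → eulerTerm q a s = 0 → D s ≠ 0 :=
    fun {a s} ha hs => mul_ne_zero
      (eulerTerm_inv_one_sub_ne_zero hq h₁ (hgen a ha a₁ ha₁) hs)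
      (eulerTerm_inv_one_sub_ne_zero hq h₂ (hgen a ha a₂ ha₂) hs)
  set E' : Set ℂ := E ∪ {s | D s = 0} with hE'
  have hE'c : IsClosed E' := hEc.union (isClosed_eq hDc continuous_const)
  have hsub : E'ᶜ ⊆ Eᶜ := compl_subset_compl.mpr subset_union_left
  have hfin : ∀ {a : ℂ}, a ∈ ({a₁, a₂} : Multiset ℂ) →
      {s | s ∈ E' ∧ eulerTerm q a s = 0}.Finite := fun {a} ha =>
    (hEfin a ha).subset fun s ⟨hs, hs0⟩ =>
      ⟨hs.resolve_right fun hD0 => hDne ha hs0 hD0, hs0⟩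
  have hid' : ∀ s, s ∉ E' → Ψ s * (eulerTerm q a₁ s * eulerTerm q a₂ s) =
      (Φ s * D s) * (B.map fun b => eulerTerm q b s).prod := by
    intro s hs
    have h := hid s fun h => hs (Or.inl h)
    simp only [Multiset.insert_eq_cons, Multiset.map_cons, Multiset.prod_cons,
      Multiset.map_singleton, Multiset.prod_singleton, hB] at h
    rw [h, hD]
    simp only [eulerTerm_def]
    ring
  have hBeq : B = {a₁, a₂} :=
    eq_pair_of_eulerTerm_identity hq h₁ h₂ hBcard hE'c (hfin ha₁) (hfin ha₂)
      ((hΦc.mono hsub).mul hDc.continuousOn) (hΨc.mono hsub)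
      (fun s hs => mul_ne_zero (hΦ s fun h => hs (Or.inl h)) fun h => hs (Or.inr h)) hid'
  refine isUnramifiedAt_and_hasFrobCharpolyAt_of_eval_eulerFactorAt σ v hcard h0 fun z => ?_
  rw [hB z, hBeq]

end Galois

/-! ### Consequences for the named fact -/

section NamedFact

open scoped Classical

variable {F : Type} [Field F] [NumberField F] {n : ℕ} {hcpt : isCompact_glFiniteIntegralLevel n F}

/-- **The almost-everywhere shadow of Prop. 4.1 is a theorem.**  If `π = π(σ)`
(`IsPiOfArtinRep`: compatibility at almost every place for *some* Satake parameter), then at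
almost every place, for *every* Satake parameter `α` of `π` at `v`, `σ` is unramified at `v` with
`charpoly σ(Frob_v) = ∏_{a ∈ α} (X - a)` — Satake parameters are unique (Flath 1979, Thm. 3;
`AutomorphicRepData.hasSatakeParamAt_unique_holds`).  The content of Gelbart's Prop. 4.1 is thus
at the finitely many remaining places. [cite: Gelbart1997, Prop. 4.1] -/
theorem IsPiOfArtinRep.eventually_forall_frobSatake {σ : FramedArtinRep F n}
    {π : AutomorphicRepData (AutomorphyDatum.gl n F hcpt)} (h : IsPiOfArtinRep σ π) :
    ∀ᶠ v in cofinite, ∀ α : Multiset ℂ, π.HasSatakeParamAt v α →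
      σ.IsUnramifiedAt v ∧ σ.HasFrobCharpolyAt v (satakePolynomial α) :=
  h.mono fun _ ⟨_, hβ, hur, hchar⟩ α hα => by
    obtain rfl := AutomorphicRepData.hasSatakeParamAt_unique_holds π hα hβ
    exact ⟨hur, hchar⟩

/-- **Prop. 4.1 from its global half.**  The named fact
`frobSatakeCompatibleAt_of_isPiOfArtinRep` follows from the statement — displayed inline as the
hypothesis `H`, it is what Jacquet–Langlands 1970, pp. 209–210 (Thm. 11.1, Cor. 11.2, Lemma 12.5,
Prop. 3.8) establish — that whenever the cuspidal `π = π(σ)` has Satake parameter `α` at `v`,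
`α` consists of non-zero numbers with `a ≠ q_v b` (`π_v` generic) and the single-place identity
(12.5.1) holds at `v` in the tolerant form of `frobSatake_of_local_identity`.
[cite: JacquetLanglands1970, proof of Thm. 12.2, pp. 209–211] -/
theorem frobSatakeCompatibleAt_of_isPiOfArtinRep_of_local_identities
    (H : ∀ {F : Type} [Field F] [NumberField F] (hcpt : isCompact_glFiniteIntegralLevel 2 F)
      (σ : FramedArtinRep F 2) (π : CuspidalAutomorphicRepData 2 F hcpt),
      IsPiOfArtinRep σ π.1 → ∀ (v : HeightOneSpectrum (𝓞 F)) (α : Multiset ℂ),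
        π.1.HasSatakeParamAt v α →
        (0 : ℂ) ∉ α ∧ (∀ a ∈ α, ∀ b ∈ α, a ≠ v.residueCard * b) ∧
        ∃ (E : Set ℂ) (Φ Ψ : ℂ → ℂ), IsClosed E ∧
          (∀ a ∈ α, {s | s ∈ E ∧ eulerTerm v.residueCard a s = 0}.Finite) ∧
          ContinuousOn Φ Eᶜ ∧ ContinuousOn Ψ Eᶜ ∧ (∀ s, s ∉ E → Φ s ≠ 0) ∧
          ∀ s, s ∉ E →
            Ψ s * (α.map fun a => eulerTerm v.residueCard a s).prod =
              Φ s * (σ.toArtinRep.eulerFactorAt v).eval ((v.residueCard : ℂ) ^ (-s)) *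
                (α.map fun a => eulerTerm v.residueCard a⁻¹ (1 - s)).prod) :
    frobSatakeCompatibleAt_of_isPiOfArtinRep := by
  intro F _ _ hcpt σ π hπ v α hα
  obtain ⟨h0, hgen, E, Φ, Ψ, hEc, hEfin, hΦc, hΨc, hΦ, hid⟩ := H hcpt σ π hπ v α hα
  exact frobSatake_of_local_identity σ v hα.card_eq h0 hgen hEc hEfin hΦc hΨc hΦ hid

end NamedFact

end Literature.NumberTheory.Automorphic
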